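import Mathlib
import Summits.ValiantsHypothesis.ValiantsHypothesis.Theorems.LiouvilleSarnakAlignedTypeICharactersMod2nBilinearSieveLinnikRange
import HarnessLib

/-!
# Route LiouvilleSarnak — support `AlignedTypeI` (stmt-ValiantsHypothesis-21040), line `characters_mod_2n`:
# only the TOP conductors `2^j`, `δ k ≤ j ≤ k`, remain (the low ones are free by the Linnik–Gallagher range)

From the unconditional Linnik–Gallagher range for `2`-power conductors (`vonMangoldtCharSum_le_linnikRange`,
`…BilinearSieveLinnikRange.lean`: `‖ψ(t, χ)‖ ≤ η t` for primitive `χ (mod 2^j)` once `log t ≥ B(η) j log 2`, `log t ≥ L₀(η)`)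
and the bilinear-sieve chain (`alignedTypeI_of_vonMangoldtPrimeCharSums`, `…BilinearSieveLambda.lean`):

* `vonMangoldtPrimeCharSums_lowConductors` — UNCONDITIONAL, in the leaf's currency: for `θ, η > 0` there are `δ > 0`, `k₂`
  with `‖ψ(t, χ)‖ ≤ η t` for all `k ≥ k₂`, `1 ≤ j ≤ δ k`, primitive `χ (mod 2^j)`, `a ≥ θ k`, `t ≥ 2^a`;
* `alignedTypeI_of_topConductorPrimeCharSums` — ★ `H_Λ^top → AlignedTypeI` (conditional by arrow, no def), where
  `H_Λ^top := ∀ θ η δ > 0 ∃ k₂ ∀ k ≥ k₂ ∀ j, δ k ≤ j → j ≤ k → ∀ χ primitive (mod 2^j) ∀ a ≥ θ k ∀ t ≥ 2^a, ‖ψ(t, χ)‖ ≤ η t`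
  asks for prime-sum bounds ONLY for the conductors `q = 2^j ∈ [x^{δ/2}, x^{1/2}]` (`x = 4^k`) at lengths `t ≥ q^{θ}` —
  `log t ≍ log q`, the powerful-modulus regime of Postnikov–Gallagher–Iwaniec (it follows from Banks–Shparlinski 2019
  Thm 2.2, cf. `…BilinearSieveFinal.lean`, and is what a zero-free region with `(1 − β) log q → ∞` for `q = 2^j` gives);
* `alignedTypeI_of_windowPrimeCharSums` — ★ the same with the lengths capped as well: `2^a ≤ t < 2^{a+1}`, `θ k ≤ a ≤ B k`
  for every `B` (beyond `B(η) k` the Linnik–Gallagher range applies again) — the residual of the leaf is the bound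
  `‖ψ(t, χ)‖ ≤ η t` for primitive `χ (mod q)`, `q = 2^j`, in the window `q^θ ≤ t ≤ q^{B/δ}`.

HONEST FRAMING. `vonMangoldtPrimeCharSums_lowConductors` is unconditional; `alignedTypeI_of_topConductorPrimeCharSums` is a
conditional result (hypothesis by arrow). The leaf `AlignedTypeI` is NOT closed here; nothing bears on `VP ≠ VNP` (NOT proved).
-/

set_option linter.dupNamespace false

noncomputable section

namespace Summit.ValiantsHypothesis.ValiantsHypothesis.Theorems.LiouvilleSarnak.AlignedTypeI.CharactersModTwoN

open Finset ArithmeticFunction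
open scoped BigOperators

/-- **Low conductors are free, in the leaf's currency (UNCONDITIONAL).** For `θ, η > 0` there are `δ > 0` and `k₂` such that
`‖ψ(t, χ)‖ ≤ η t` for all `k ≥ k₂`, all `1 ≤ j ≤ δ k`, all primitive `χ (mod 2^j)`, all `a ≥ θ k` and `t ≥ 2^a`
(`log t ≥ θ k log 2 ≥ (θ/δ) j log 2 = B j log 2`). [folklore] -/
theorem vonMangoldtPrimeCharSums_lowConductors :
    ∀ th : ℝ, 0 < th → ∀ η : ℝ, 0 < η → ∃ δ : ℝ, 0 < δ ∧ ∃ k₂ : ℕ, ∀ k : ℕ, k₂ ≤ k → ∀ j : ℕ, 1 ≤ j → (j : ℝ) ≤ δ * k →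
      ∀ χ : DirichletCharacter ℂ (2 ^ j), χ.IsPrimitive → ∀ a : ℕ, th * k ≤ a → ∀ t : ℕ, 2 ^ a ≤ t →
        ‖∑ n ∈ Finset.Ioc 0 t, ((vonMangoldt n : ℝ) : ℂ) * χ (n : ZMod (2 ^ j))‖ ≤ η * t := by
  intro th hth η hη
  obtain ⟨B, hB1, L₀, hL₀1, hmain⟩ := vonMangoldtCharSum_le_linnikRange η hη
  have hlog2 : 0 < Real.log 2 := Real.log_pos (by norm_num)
  have hB0 : 0 < B := by linarith
  obtain ⟨k₂, hk₂⟩ : ∃ k₂ : ℕ, L₀ / (th * Real.log 2) ≤ k₂ := exists_nat_ge _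
  refine ⟨th / B, by positivity, k₂, fun k hk j hj hjδ χ hχ a ha t ht => ?_⟩
  have hkR : (k₂ : ℝ) ≤ k := by exact_mod_cast hk
  have ht1 : 1 ≤ t := le_trans Nat.one_le_two_pow ht
  have ht0 : (0 : ℝ) < t := by exact_mod_cast (show 0 < t by omega)
  have htR : (2 : ℝ) ^ a ≤ t := by exact_mod_cast ht
  -- `log t ≥ a log 2 ≥ θ k log 2`
  have hlogt : th * k * Real.log 2 ≤ Real.log t := by
    have h1 : Real.log ((2 : ℝ) ^ a) ≤ Real.log t := Real.log_le_log (by positivity) htR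
    rw [Real.log_pow] at h1
    have h2 : th * k * Real.log 2 ≤ a * Real.log 2 := mul_le_mul_of_nonneg_right ha hlog2.le
    linarith
  refine hmain j hj χ hχ t ?_ ?_
  · -- `L₀ ≤ θ k₂ log 2 ≤ θ k log 2 ≤ log t`
    have h1 : L₀ ≤ th * k₂ * Real.log 2 := by
      have := (div_le_iff₀ (by positivity)).mp hk₂; linarith
    have h2 : th * k₂ * Real.log 2 ≤ th * k * Real.log 2 := by gcongr
    linarith
  · -- `B j log 2 ≤ B (θ/B) k log 2 = θ k log 2 ≤ log t`
    have h1 : B * j * Real.log 2 ≤ B * (th / B * k) * Real.log 2 := by gcongr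
    have hBth : B * (th / B) = th := mul_div_cancel₀ th (ne_of_gt hB0)
    have h2 : B * (th / B * k) * Real.log 2 = th * k * Real.log 2 := by
      rw [← mul_assoc, hBth]
    linarith

/-- ★ **`AlignedTypeI` from `ψ(t, χ)`-bounds for the TOP conductors only** (CONDITIONAL by arrow, no def): if for all
`θ, η, δ > 0` there is `k₂` with `‖Σ_{n ≤ t} Λ(n) χ(n)‖ ≤ η t` for all `k ≥ k₂`, all `j` with `δ k ≤ j ≤ k`, all primitive
`χ (mod 2^j)`, `a ≥ θ k`, `t ≥ 2^a` — the conductors `q = 2^j ≥ x^{δ/2}` at lengths `t ≥ q^θ`, i.e. the powerful-modulus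
regime `log t ≍ log q` of Postnikov–Gallagher–Iwaniec / Banks–Shparlinski — then the leaf `AlignedTypeI` holds: the low
conductors `j ≤ δ k` are supplied unconditionally by `vonMangoldtPrimeCharSums_lowConductors`. [folklore] -/
theorem alignedTypeI_of_topConductorPrimeCharSums
    (h : ∀ th : ℝ, 0 < th → ∀ η : ℝ, 0 < η → ∀ δ : ℝ, 0 < δ → ∃ k₂ : ℕ, ∀ k : ℕ, k₂ ≤ k →
      ∀ j : ℕ, 1 ≤ j → δ * k ≤ j → j ≤ k →
      ∀ χ : DirichletCharacter ℂ (2 ^ j), χ.IsPrimitive → ∀ a : ℕ, th * k ≤ a → ∀ t : ℕ, 2 ^ a ≤ t →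
        ‖∑ n ∈ Finset.Ioc 0 t, ((vonMangoldt n : ℝ) : ℂ) * χ (n : ZMod (2 ^ j))‖ ≤ η * t) :
    Summit.ValiantsHypothesis.ValiantsHypothesis.Theses.LiouvilleSarnak.AlignedTypeI := by
  refine alignedTypeI_of_vonMangoldtPrimeCharSums fun th hth η hη => ?_
  obtain ⟨δ, hδ, k₂, hlow⟩ := vonMangoldtPrimeCharSums_lowConductors th hth η hη
  obtain ⟨k₂', htop⟩ := h th hth η hη δ hδ
  refine ⟨max k₂ k₂', fun k hk j hj1 hjk χ hχ a ha t ht => ?_⟩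
  rcases le_total (j : ℝ) (δ * k) with hjδ | hjδ
  · exact hlow k (le_trans (le_max_left _ _) hk) j hj1 hjδ χ hχ a ha t ht
  · exact htop k (le_trans (le_max_right _ _) hk) j hj1 hjδ hjk χ hχ a ha t ht

/-- ★ **`AlignedTypeI` from `ψ(t, χ)`-bounds in the WINDOW `log t ≍ log q` only** (CONDITIONAL by arrow, no def): it suffices
to bound `‖ψ(t, χ)‖ ≤ η t` for the top conductors `2^j`, `δ k ≤ j ≤ k`, at the dyadic lengths `2^a ≤ t < 2^{a+1}` with
`θ k ≤ a ≤ B k` — for EVERY `B` (the lengths `t ≥ 2^{(B(η)+1) k} ≥ q^{B(η)+1}` are again free by the Linnik–Gallagher range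
`vonMangoldtCharSum_le_linnikRange`).  So the leaf's residual is a statement about primitive characters of conductor
`q = 2^j` at lengths `q^{θ} ≤ t ≤ q^{B/δ}`: exactly the powerful-modulus regime. [folklore] -/
theorem alignedTypeI_of_windowPrimeCharSums
    (h : ∀ th : ℝ, 0 < th → ∀ η : ℝ, 0 < η → ∀ δ : ℝ, 0 < δ → ∀ B : ℝ, 0 < B → ∃ k₂ : ℕ, ∀ k : ℕ, k₂ ≤ k →
      ∀ j : ℕ, 1 ≤ j → δ * k ≤ j → j ≤ k →
      ∀ χ : DirichletCharacter ℂ (2 ^ j), χ.IsPrimitive → ∀ a : ℕ, th * k ≤ a → (a : ℝ) ≤ B * k →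
        ∀ t : ℕ, 2 ^ a ≤ t → t < 2 ^ (a + 1) →
        ‖∑ n ∈ Finset.Ioc 0 t, ((vonMangoldt n : ℝ) : ℂ) * χ (n : ZMod (2 ^ j))‖ ≤ η * t) :
    Summit.ValiantsHypothesis.ValiantsHypothesis.Theses.LiouvilleSarnak.AlignedTypeI := by
  refine alignedTypeI_of_topConductorPrimeCharSums fun th hth η hη δ hδ => ?_
  obtain ⟨B, hB1, L₀, hL₀1, hlin⟩ := vonMangoldtCharSum_le_linnikRange η hη
  have hlog2 : 0 < Real.log 2 := Real.log_pos (by norm_num)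
  obtain ⟨k₂, hwin⟩ := h th hth η hη δ hδ (B + 1) (by linarith)
  obtain ⟨k₃, hk₃⟩ : ∃ k₃ : ℕ, L₀ / Real.log 2 ≤ k₃ := exists_nat_ge _
  refine ⟨max k₂ k₃, fun k hk j hj1 hjδ hjk χ hχ a ha t ht => ?_⟩
  have hk₂k : k₂ ≤ k := le_trans (le_max_left _ _) hk
  have hk₃k : (k₃ : ℝ) ≤ k := by exact_mod_cast le_trans (le_max_right _ _) hk
  have ht0 : t ≠ 0 := by have := Nat.one_le_two_pow.trans ht; omega
  -- the dyadic exponent of `t`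
  set a' : ℕ := Nat.log 2 t with ha'
  have h1 : 2 ^ a' ≤ t := Nat.pow_log_le_self 2 ht0
  have h2 : t < 2 ^ (a' + 1) := Nat.lt_pow_succ_log_self (by norm_num) t
  have haa' : a ≤ a' := Nat.le_log_of_pow_le (by norm_num) ht
  have ha' : th * k ≤ a' := ha.trans (by exact_mod_cast haa')
  by_cases hw : (a' : ℝ) ≤ (B + 1) * k
  · exact hwin k hk₂k j hj1 hjδ hjk χ hχ a' ha' hw t h1 h2
  · -- beyond the window: `log t ≥ a' log 2 > (B+1) k log 2`, the Linnik–Gallagher range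
    rw [not_le] at hw
    have ht0R : (0 : ℝ) < t := by exact_mod_cast Nat.pos_of_ne_zero ht0
    have hlogt : (a' : ℝ) * Real.log 2 ≤ Real.log t := by
      have h3 : Real.log ((2 : ℝ) ^ a') ≤ Real.log t :=
        Real.log_le_log (by positivity) (by exact_mod_cast h1)
      rwa [Real.log_pow] at h3
    have hjk' : (j : ℝ) ≤ k := by exact_mod_cast hjk
    have hk0 : (0 : ℝ) ≤ k := Nat.cast_nonneg k
    refine hlin j hj1 χ hχ t ?_ ?_
    · -- `L₀ ≤ k₃ log 2 ≤ k log 2 ≤ (B+1) k log 2 ≤ a' log 2 ≤ log t`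
      have h4 : L₀ ≤ k₃ * Real.log 2 := by
        have := (div_le_iff₀ hlog2).mp hk₃; linarith
      have h5 : (k₃ : ℝ) * Real.log 2 ≤ k * Real.log 2 := mul_le_mul_of_nonneg_right hk₃k hlog2.le
      have h6 : (k : ℝ) * Real.log 2 ≤ (B + 1) * k * Real.log 2 := by nlinarith
      have h7 : (B + 1) * k * Real.log 2 ≤ a' * Real.log 2 :=
        mul_le_mul_of_nonneg_right hw.le hlog2.le
      linarith
    · have h4 : B * j * Real.log 2 ≤ B * k * Real.log 2 := by gcongr
      have h6 : B * k * Real.log 2 ≤ (B + 1) * k * Real.log 2 := by nlinarith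
      have h7 : (B + 1) * k * Real.log 2 ≤ a' * Real.log 2 :=
        mul_le_mul_of_nonneg_right hw.le hlog2.le
      linarith

end Summit.ValiantsHypothesis.ValiantsHypothesis.Theorems.LiouvilleSarnak.AlignedTypeI.CharactersModTwoN
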